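import Literature.LinearAlgebra.Matrix.CartanAlgebraDetNorm
import Literature.NumberTheory.AdelicBaseChange.AdeleNormGalois
import Literature.NumberTheory.AdelicBaseChange.AdeleNormTower
import HarnessLib

/-!
# The determinant of the adelic Cartan class as a product of factor norms: `det x_g = ∏_𝔪 N_{K_𝔪/L}(x_𝔪)` in `𝔸_L`
# (Rogawski 1990 §3.5 p. 29–30; Cassels–Fröhlich II §19 (19.1), (19.7))

Topic `NumberTheory/GaloisRepresentations`; namespace `Literature.NumberTheory.GaloisRepresentations`.  THEOREMS ONLY (no definition, no
instance, no notation, no named fact); universe `Type`.  Fourth sequel of ★ `HasseNormEtaleInvolution` (row G6∕R6d «det-reading» of the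
floor-0 unitary stabilisation, engine T1): the adelic instantiation `R := 𝔸_L` of ★ `LinearAlgebra/Matrix/CartanAlgebraDetNorm` for the
consumer `Rogawski1990/CartanObstructionIndicator` (`sum_cartanObsFun_eq_zero`: the obstruction vector lies in the sum-zero hyperplane because
`det x_g = det g · σ(det g)` is a norm from `L`).  The carrier of ★ R3′∕R3″ is `𝔸_F ⊗_F B` (`F = L⁺`, `B = L[γ]`); the norms live on
`𝔸_L ⊗_L B∕𝔪`; the two are joined by TRANSFER isomorphisms `θ : 𝔸_F ⊗_F M ≅ 𝔸_L ⊗_L M`, `θ(a ⊗ m) = con(a) ⊗ m` (any `L`-algebra `M`),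
quantified with their value on pure tensors (def-free), existence in §1.

* §1 **(T0) `exists_ringEquiv_apply_tmul`**: `∃ θ : 𝔸_F ⊗_F M ≃+* 𝔸_L ⊗_L M, θ (a ⊗ m) = con_{L/F} a ⊗ m` (Mathlib `Algebra.TensorProduct.comm` ∕
  `cancelBaseChange` ∕ `congr` with the packet's (19.1) `NumberField.AdeleRing.baseChangeAlgEquiv F L : L ⊗_F 𝔸_F ≃ₐ[L] 𝔸_L`);
  `ringEquiv_apply_eq_of_apply_tmul` (two transfers agree).
* §2 **(N1) `det_eq_prod_norm_transfer`**: for `γ ∈ M_N(L)` regular semisimple, ANY `F`-algebra map `Ψ : 𝔸_F ⊗_F L[γ] → M_N(𝔸_L)` with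
  `Ψ(r ⊗ b) = con(r) • b` (the glue of ★ `HasseNormEtaleInvolutionMatrix` ∕ R6d `adelicCartanGlue`) and any transfers `θ_𝔪`:
  `det (Ψ X) = ∏_{𝔪 ∈ MaxSpec L[γ]} N_{(𝔸_L ⊗_L K_𝔪)/𝔸_L}(θ_𝔪 ((1 ⊗ π_𝔪) X))` — ★ `det_eq_prod_norm_map_mk` at `R = 𝔸_L` along `θ_{L[γ]}`.
* §3 **(N2) `norm_transfer_comap_eq`** (the SWAPPED PAIRS `{𝔪, τ𝔪}`): for an `F`-involution `τ` of an `L`-algebra `M` that is `σ`-SEMILINEAR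
  (`τ(ℓ m) = σ(ℓ) τ(m)`, `σ ∈ Aut(L/F)`, `σ_𝔸 = σ ⊗ 1` on `𝔸_L`) and an ideal `J`:
  `N(θ₁((1 ⊗ π_{τ⁻¹J}) X)) = σ_𝔸 (N(θ₂((1 ⊗ π_J)((1 ⊗ τ) X))))` — Mathlib `Algebra.norm_eq_of_equiv_equiv` along the `σ_𝔸`-semilinear
  isomorphism `𝔸_L ⊗_L M∕τ⁻¹J ≅ 𝔸_L ⊗_L M∕J` induced by `τ`; so for a `τ`-fixed `X` the norms at `τ𝔪 ≠ 𝔪` pair off as `y · σ_𝔸 y`.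

## References
* J. D. Rogawski, *Automorphic Representations of Unitary Groups in Three Variables*, Ann. of Math. Stud. 123 (1990), §3.5 Prop. 3.5.2 and
  p. 29–30 [Rogawski1990].
* J. W. S. Cassels, A. Fröhlich (eds.), *Algebraic Number Theory* (1967), Ch. II (Cassels) §19 (19.1), (19.7); Ch. VII (Tate) §7.1 [CasselsFrohlichANT1967].
-/

set_option autoImplicit false

noncomputable section

open scoped TensorProduct NumberField NumberField.AdeleRing

namespace Literature.NumberTheory.GaloisRepresentations

open NumberField
open Literature.NumberTheory.AdelicBaseChange
open Literature.LinearAlgebra.Matrix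

/-! ## §1 (T0) The transfer `θ : 𝔸_F ⊗_F M ≅ 𝔸_L ⊗_L M`, `a ⊗ m ↦ con(a) ⊗ m` -/

section Transfer

variable (F L : Type) [Field F] [NumberField F] [Field L] [NumberField L] [Algebra F L]
  (M : Type) [CommRing M] [Algebra F M] [Algebra L M] [IsScalarTower F L M]

/-- **(T0) the transfer isomorphism `θ : 𝔸_F ⊗_F M ≅ 𝔸_L ⊗_L M`, `θ(a ⊗ m) = con_{L/F}(a) ⊗ m`** for any commutative `L`-algebra `M`
(`𝔸_L ⊗_L M = (𝔸_F ⊗_F L) ⊗_L M = 𝔸_F ⊗_F M` through (19.1) `L ⊗_F 𝔸_F ≅ 𝔸_L`). [cite: CasselsFrohlichANT1967, Ch. II §19 (19.1)–(19.2)] -/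
theorem exists_ringEquiv_apply_tmul :
    ∃ θ : AdeleRing (𝓞 F) F ⊗[F] M ≃+* AdeleRing (𝓞 L) L ⊗[L] M,
      ∀ (a : AdeleRing (𝓞 F) F) (m : M), θ (a ⊗ₜ m) = NumberField.AdeleRing.baseChange F L a ⊗ₜ m := by
  refine ⟨(((Algebra.TensorProduct.comm F (AdeleRing (𝓞 F) F) M).toRingEquiv.trans
      (Algebra.TensorProduct.cancelBaseChange F L L M (AdeleRing (𝓞 F) F)).symm.toRingEquiv).trans
      (Algebra.TensorProduct.congr (AlgEquiv.refl : M ≃ₐ[L] M) (NumberField.AdeleRing.baseChangeAlgEquiv F L)).toRingEquiv).trans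
      (Algebra.TensorProduct.comm L M (AdeleRing (𝓞 L) L)).toRingEquiv, fun a m => ?_⟩
  simp only [RingEquiv.coe_trans, Function.comp_apply, AlgEquiv.coe_ringEquiv, Algebra.TensorProduct.comm_tmul,
    Algebra.TensorProduct.cancelBaseChange_symm_tmul, Algebra.TensorProduct.congr_apply, Algebra.TensorProduct.map_tmul]
  change NumberField.AdeleRing.baseChangeAlgEquiv F L (1 ⊗ₜ a) ⊗ₜ[L] AlgEquiv.refl (R := L) (A₁ := M) m = _
  rw [NumberField.AdeleRing.baseChangeAlgEquiv_apply, map_one, one_mul, AlgEquiv.coe_refl, id_eq]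

omit [IsScalarTower F L M] in
/-- Two transfers with the same values on pure tensors agree. [cite: CasselsFrohlichANT1967, Ch. II §19 (19.1)] -/
theorem ringEquiv_apply_eq_of_apply_tmul {θ θ' : AdeleRing (𝓞 F) F ⊗[F] M ≃+* AdeleRing (𝓞 L) L ⊗[L] M}
    (hθ : ∀ (a : AdeleRing (𝓞 F) F) (m : M), θ (a ⊗ₜ m) = NumberField.AdeleRing.baseChange F L a ⊗ₜ m)
    (hθ' : ∀ (a : AdeleRing (𝓞 F) F) (m : M), θ' (a ⊗ₜ m) = NumberField.AdeleRing.baseChange F L a ⊗ₜ m)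
    (x : AdeleRing (𝓞 F) F ⊗[F] M) : θ x = θ' x := by
  induction x using TensorProduct.induction_on with
  | zero => simp only [map_zero]
  | tmul a m => rw [hθ, hθ']
  | add x y hx hy => simp only [map_add, hx, hy]

end Transfer

/-! ## §2 (N1) `det (Ψ X) = ∏_𝔪 N_{(𝔸_L ⊗_L K_𝔪)/𝔸_L}(θ_𝔪((1 ⊗ π_𝔪) X))` -/

section Det

variable {F L : Type} [Field F] [NumberField F] [Field L] [NumberField L] [Algebra F L]
  [Algebra F (AdeleRing (𝓞 L) L)] {N : ℕ} {γ : Matrix (Fin N) (Fin N) L}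

set_option synthInstance.maxHeartbeats 80000 in
set_option maxHeartbeats 800000 in
/-- **(N1) `det (Ψ X) = ∏_𝔪 N_{K_𝔪/L}((1 ⊗ π_𝔪) X)` as adèles of `L`** — for `γ` regular semisimple, `B = L[γ]` (reduced, ★
`isReduced_adjoin_singleton`), ANY `F`-algebra map `Ψ : 𝔸_F ⊗_F B → M_N(𝔸_L)` with `Ψ (r ⊗ b) = con(r) • b` and any transfers `θ_𝔪` of the
factors `K_𝔪 = B∕𝔪`: `det (Ψ X) = ∏_𝔪 Nm_{(𝔸_L ⊗_L K_𝔪)/𝔸_L}(θ_𝔪 ((1 ⊗ π_𝔪) X))` (★ `det_eq_prod_norm_map_mk` at `R = 𝔸_L`, read through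
`θ_B`).  With (19.1) `𝔸_L ⊗_L K_𝔪 ≅ 𝔸_{K_𝔪}` each factor is Cassels's `N_{K_𝔪/L}` (19.7) of the `𝔪`-component — the «`det x = ∏ N_{K_i/L}(x_i)`»
of the obstruction computation. [cite: Rogawski1990, §3.5 Prop. 3.5.2] [cite: CasselsFrohlichANT1967, Ch. II §19 (19.7)] -/
theorem det_eq_prod_norm_transfer (hreg : γ.charpoly.Separable)
    [Fintype (MaximalSpectrum ↥(Algebra.adjoin L ({γ} : Set (Matrix (Fin N) (Fin N) L))))]
    (Ψ : AdeleRing (𝓞 F) F ⊗[F] ↥(Algebra.adjoin L ({γ} : Set (Matrix (Fin N) (Fin N) L))) →ₐ[F]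
      Matrix (Fin N) (Fin N) (AdeleRing (𝓞 L) L))
    (hΨ : ∀ (r : AdeleRing (𝓞 F) F) (b : ↥(Algebra.adjoin L ({γ} : Set (Matrix (Fin N) (Fin N) L)))),
      Ψ (r ⊗ₜ b) = NumberField.AdeleRing.baseChange F L r • (b : Matrix (Fin N) (Fin N) L).map (algebraMap L (AdeleRing (𝓞 L) L)))
    (θ : ∀ I : MaximalSpectrum ↥(Algebra.adjoin L ({γ} : Set (Matrix (Fin N) (Fin N) L))),
      AdeleRing (𝓞 F) F ⊗[F] (↥(Algebra.adjoin L ({γ} : Set (Matrix (Fin N) (Fin N) L))) ⧸ I.asIdeal) ≃+*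
        AdeleRing (𝓞 L) L ⊗[L] (↥(Algebra.adjoin L ({γ} : Set (Matrix (Fin N) (Fin N) L))) ⧸ I.asIdeal))
    (hθ : ∀ I (a : AdeleRing (𝓞 F) F) (m : ↥(Algebra.adjoin L ({γ} : Set (Matrix (Fin N) (Fin N) L))) ⧸ I.asIdeal),
      θ I (a ⊗ₜ m) = NumberField.AdeleRing.baseChange F L a ⊗ₜ m)
    (X : AdeleRing (𝓞 F) F ⊗[F] ↥(Algebra.adjoin L ({γ} : Set (Matrix (Fin N) (Fin N) L)))) :
    (Ψ X).det = ∏ I : MaximalSpectrum ↥(Algebra.adjoin L ({γ} : Set (Matrix (Fin N) (Fin N) L))),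
      Algebra.norm (AdeleRing (𝓞 L) L) (θ I (Algebra.TensorProduct.map (AlgHom.id (AdeleRing (𝓞 F) F) (AdeleRing (𝓞 F) F))
        (Ideal.Quotient.mkₐ F I.asIdeal) X)) := by
  -- the canonical `𝔸_L`-algebra map `Ψ' : 𝔸_L ⊗_L B → M_N(𝔸_L)`, `r ⊗ b ↦ r • b`
  obtain ⟨Ψ', hΨ'⟩ : ∃ Ψ' : AdeleRing (𝓞 L) L ⊗[L] ↥(Algebra.adjoin L ({γ} : Set (Matrix (Fin N) (Fin N) L))) →ₐ[AdeleRing (𝓞 L) L]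
      Matrix (Fin N) (Fin N) (AdeleRing (𝓞 L) L), ∀ (r : AdeleRing (𝓞 L) L) (b : ↥(Algebra.adjoin L ({γ} : Set (Matrix (Fin N) (Fin N) L)))),
      Ψ' (r ⊗ₜ b) = r • (b : Matrix (Fin N) (Fin N) L).map (algebraMap L (AdeleRing (𝓞 L) L)) :=
    ⟨Algebra.TensorProduct.lift (Algebra.ofId (AdeleRing (𝓞 L) L) (Matrix (Fin N) (Fin N) (AdeleRing (𝓞 L) L)))
      (((Algebra.ofId L (AdeleRing (𝓞 L) L)).mapMatrix).comp (Algebra.adjoin L ({γ} : Set (Matrix (Fin N) (Fin N) L))).val)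
      (fun r b => Algebra.commute_algebraMap_left r _), fun r b => by
        rw [Algebra.TensorProduct.lift_tmul, Algebra.smul_def]
        rfl⟩
  -- transfer for `B` itself, and `Ψ = Ψ' ∘ θ_B`
  obtain ⟨θB, hθB⟩ := exists_ringEquiv_apply_tmul F L ↥(Algebra.adjoin L ({γ} : Set (Matrix (Fin N) (Fin N) L)))
  have hΨΨ' : ∀ Y, Ψ Y = Ψ' (θB Y) := by
    intro Y
    induction Y using TensorProduct.induction_on with
    | zero => rw [← TensorProduct.zero_tmul (AdeleRing (𝓞 F) F) (0 : ↥(Algebra.adjoin L ({γ} : Set (Matrix (Fin N) (Fin N) L)))),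
        hΨ, hθB, hΨ']
    | tmul a b => rw [hΨ, hθB, hΨ']
    | add x y hx hy => rw [θB.map_add, map_add, map_add, hx, hy]
  -- the factor maps commute with the transfers
  have hfac : ∀ (I : MaximalSpectrum ↥(Algebra.adjoin L ({γ} : Set (Matrix (Fin N) (Fin N) L)))) (Y),
      Algebra.TensorProduct.map (AlgHom.id (AdeleRing (𝓞 L) L) (AdeleRing (𝓞 L) L)) (Ideal.Quotient.mkₐ L I.asIdeal) (θB Y) =
        θ I (Algebra.TensorProduct.map (AlgHom.id (AdeleRing (𝓞 F) F) (AdeleRing (𝓞 F) F)) (Ideal.Quotient.mkₐ F I.asIdeal) Y) := by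
    intro I Y
    induction Y using TensorProduct.induction_on with
    | zero =>
        rw [← TensorProduct.zero_tmul (AdeleRing (𝓞 F) F) (0 : ↥(Algebra.adjoin L ({γ} : Set (Matrix (Fin N) (Fin N) L)))),
          hθB, Algebra.TensorProduct.map_tmul, Algebra.TensorProduct.map_tmul, hθ]
        rfl
    | tmul a b =>
        rw [hθB, Algebra.TensorProduct.map_tmul, Algebra.TensorProduct.map_tmul, hθ]
        rfl
    | add x y hx hy => rw [θB.map_add, map_add, map_add, (θ I).map_add, hx, hy]
  have h1 := det_eq_prod_norm_map_mk γ (AdeleRing (𝓞 L) L) hreg Ψ' hΨ' (θB X)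
  rw [hΨΨ' X, h1]
  refine Finset.prod_congr rfl fun I _ => ?_
  rw [hfac]

end Det

end Literature.NumberTheory.GaloisRepresentations

end
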